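import Mathlib.Combinatorics.SimpleGraph.Connectivity.Connected
import Mathlib.Data.Real.Basic
import Mathlib.Data.Fintype.Powerset
import Mathlib.Data.Finset.BooleanAlgebra
import Mathlib.Data.Sym.Sym2
import Mathlib.Algebra.BigOperators.Ring.Finset
import Mathlib.Algebra.Order.BigOperators.Group.Finset
import Mathlib.Tactic.Linarith
import Mathlib.Tactic.Ring
import HarnessLib

/-!
# Coefficientwise (two-colouring) form of van den Berg–Häggström–Kahn's Theorem 1.4 when one source is a leaf

Support file (`--supports stmt-CriticalPhenomena-4575`, closed), prover `prim-cplus-coupling` (gen 22); companion of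
`…KnQuestion8CoefficientwiseHarris.lean` (prim-lf-2, the positive-association rung).  Memo
`prim-cplus-coupling/A5-COUPLING-gen22.md` §1.7 ("Theorem P").  No definitions of mathematical objects beyond local
abbreviations, no named facts, no sorries; standard axioms.

Setting.  A finite multigraph is given by a vertex type `V`, an edge type `ι` and the endpoint map `ends : ι → Sym2 V`.  For a
set `t : Finset ι` of "colour-1" (red) edges — its complement `tᶜ` being the "colour-2" (blue) edges — `OG[t]` is the graph whose
adjacency is "joined by a red non-loop edge", and `CL[t, a]` is the red vertex cluster of `a`.  The two-colouring (all-edge joint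
Bernstein) form of vdBHK's conditional NEGATIVE correlation of the clusters of two sources `x`, `z` given `{x ↮ z}`
(Thm. 1.4: `E[f g | x ↮ z] ≤ E[f | x ↮ z] E[g | x ↮ z]`, `f` increasing in `C_x`, `g` increasing in `C_z`) is the counting inequality
  `Δ := Σ_{t ⊆ ι} 1[x ↮ z in t] · 1[x ↮ z in tᶜ] · f(cl t x) · (g(cl tᶜ z) − g(cl t z)) ≥ 0`
("cross-colour ≥ same-colour"); its validity on every minor of a graph `G` is equivalent to the nonnegativity of every joint all-edge
Bernstein coefficient of the Thm-1.4 polynomial on `G` (memo §1.1), and it holds in every exact census through all graphs on 7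
vertices (memo §3) but is open in general.  This file proves it when the relay `z` is a LEAF: all edges meeting `z` coincide with one
edge `e₀` (`twoColouring_bhk14_leaf`).  Proof (memo §1.7): (i) by the global colour swap `t ↦ tᶜ`,
`Δ = Σ_D (g(cl t z) − g{z})·(f(cl tᶜ x) − f(cl t x))`; (ii) the weight vanishes unless `e₀ ∈ t`, and then `z` has no blue edge, so
the constraint `x ↮ z in tᶜ` is automatic; (iii) on `T = {e₀ ∈ t, x ∉ cl t z}` the map `Φ t = (t ∩ I) ∪ (Iᶜ \ t)`, `I` = edges meeting
`cl t z`, is an involution preserving `cl · z` and with `cl t x ⊆ cl (Φ t)ᶜ x` (a red path from `x` never meets the red cluster of `z`);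
reindexing `Σ_T w f(cl (Φ t)ᶜ x)` by `Φ` gives `Σ_T w f(cl t x) ≤ Σ_T w f(cl tᶜ x)`.
[cite: VandenbergHaggstromKahn2005, Thm. 1.4 (p. 7)]; context [cite: KozmaNitzan2024, Questions 8–9 (§5.5 p. 36)].
-/

noncomputable section

open Finset
open scoped Classical

namespace Summit.CriticalPhenomena.PercolationContinuityZ3.Theorems

namespace CoefficientwiseNA

variable {V : Type*} [Fintype V] [DecidableEq V] {ι : Type*} [Fintype ι] [DecidableEq ι]

variable (ends : ι → Sym2 V)

/-- The graph of the red edges `t` (Mathlib's `fromEdgeSet` of the set of endpoint pairs): `u ~ v` iff `u ≠ v` and some edge of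
`t` has endpoints `{u, v}`.  Local notation only (no new definitions in this file). -/
local notation "OG[" t "]" => SimpleGraph.fromEdgeSet (Finset.image ends t : Set (Sym2 V))
/-- The red vertex cluster of `a`: the vertices joined to `a` by a path of edges of `t`. -/
local notation "CL[" t ", " a "]" => Finset.filter (fun v => SimpleGraph.Reachable (OG[t]) a v) Finset.univ
/-- The edges meeting a vertex set `S`. -/
local notation "MEETS[" S "]" => Finset.filter (fun e => ∃ v ∈ S, v ∈ ends e) Finset.univ
/-- Keep the colours on `I`, swap them off `I`. -/
local notation "FLIP[" t ", " I "]" => ((t ∩ I) ∪ (Iᶜ \ t))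
/-- The involution of step (iii): keep the colours on the edges meeting the red cluster of `z`, swap all the others. -/
local notation "PHI[" t ", " z "]" => FLIP[t, MEETS[CL[t, z]]]


omit [Fintype V] [Fintype ι] [DecidableEq ι] in
/-- Adjacency in the red graph. [folklore] -/
theorem og_adj {t : Finset ι} {u v : V} : (OG[t]).Adj u v ↔ u ≠ v ∧ ∃ e ∈ t, ends e = s(u, v) := by
  rw [SimpleGraph.fromEdgeSet_adj, Finset.mem_coe, Finset.mem_image]
  tauto

omit [Fintype ι] [DecidableEq ι] in
/-- Membership in the red cluster is reachability in the red graph. [folklore] -/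
theorem mem_cl {t : Finset ι} {a v : V} : v ∈ CL[t, a] ↔ (OG[t]).Reachable a v := by
  simp

omit [Fintype ι] [DecidableEq ι] in
/-- A vertex lies in its own cluster. [folklore] -/
theorem self_mem_cl (t : Finset ι) (a : V) : a ∈ CL[t, a] :=
  (mem_cl ends).2 (SimpleGraph.Reachable.refl a)

omit [Fintype V] [Fintype ι] [DecidableEq ι] in
/-- `og` is monotone in the edge set. [folklore] -/
theorem og_mono {s t : Finset ι} (h : s ⊆ t) : OG[s] ≤ OG[t] := by
  intro u v huv
  obtain ⟨hne, e, he, hends⟩ := (og_adj ends).1 huv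
  exact (og_adj ends).2 ⟨hne, e, h he, hends⟩

omit [Fintype ι] [DecidableEq ι] in
/-- Clusters are monotone in the edge set. [folklore] -/
theorem cl_mono {s t : Finset ι} (h : s ⊆ t) (a : V) : CL[s, a] ⊆ CL[t, a] := by
  intro v hv
  exact (mem_cl ends).2 (((mem_cl ends).1 hv).mono (og_mono ends h))

omit [Fintype V] [DecidableEq ι] in
/-- Unfolding of `meets`. [folklore] -/
theorem mem_meets {S : Finset V} {e : ι} : e ∈ MEETS[S] ↔ ∃ v ∈ S, v ∈ ends e := by
  simp

omit [Fintype V] [DecidableEq V] in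
/-- Unfolding of `flipOff`: an edge of `I` keeps its colour, an edge off `I` changes it. [folklore] -/
theorem mem_flipOff {t I : Finset ι} {e : ι} : e ∈ FLIP[t, I] ↔ (e ∈ I ∧ e ∈ t) ∨ (e ∉ I ∧ e ∉ t) := by
  simp only [mem_union, mem_inter, mem_sdiff, mem_compl]
  tauto

omit [Fintype V] [DecidableEq V] in
/-- `FLIP[t, I]` agrees with `t` on `I`. [folklore] -/
theorem flipOff_inter (t I : Finset ι) : FLIP[t, I] ∩ I = t ∩ I := by
  ext e
  simp only [mem_inter, mem_flipOff]
  tauto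

/-- If two colourings agree on the edges meeting the red cluster `S` of `z` in the first, then `z` has the same red cluster in the
second. [folklore] -/
theorem cl_eq_of_agree {s t : Finset ι} {z : V} (h : s ∩ MEETS[CL[t, z]] = t ∩ MEETS[CL[t, z]]) :
    CL[s, z] = CL[t, z] := by
  have key : ∀ {e : ι}, e ∈ MEETS[CL[t, z]] → (e ∈ s ↔ e ∈ t) := by
    intro e he
    constructor
    · intro hs
      have : e ∈ s ∩ MEETS[CL[t, z]] := mem_inter.2 ⟨hs, he⟩
      rw [h] at this
      exact (mem_inter.1 this).1
    · intro ht
      have : e ∈ t ∩ MEETS[CL[t, z]] := mem_inter.2 ⟨ht, he⟩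
      rw [← h] at this
      exact (mem_inter.1 this).1
  ext v
  rw [mem_cl, mem_cl, SimpleGraph.reachable_iff_reflTransGen, SimpleGraph.reachable_iff_reflTransGen]
  constructor
  · -- a red path of `s` from `z` stays inside the `t`-cluster of `z`
    intro hv
    induction hv with
    | refl => exact Relation.ReflTransGen.refl
    | @tail b c _ hbc ih =>
      obtain ⟨hne, e, hes, hends⟩ := (og_adj ends).1 hbc
      have hb : b ∈ CL[t, z] :=
        (mem_cl ends).2 ((SimpleGraph.reachable_iff_reflTransGen _ _).2 ih)
      have he : e ∈ MEETS[CL[t, z]] :=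
        (mem_meets ends).2 ⟨b, hb, by rw [hends]; exact Sym2.mem_mk_left b c⟩
      have het : e ∈ t := (key he).1 hes
      exact Relation.ReflTransGen.tail ih ((og_adj ends).2 ⟨hne, e, het, hends⟩)
  · intro hv
    induction hv with
    | refl => exact Relation.ReflTransGen.refl
    | @tail b c hab hbc ih =>
      obtain ⟨hne, e, het, hends⟩ := (og_adj ends).1 hbc
      have hb : b ∈ CL[t, z] :=
        (mem_cl ends).2 ((SimpleGraph.reachable_iff_reflTransGen _ _).2 hab)
      have he : e ∈ MEETS[CL[t, z]] :=
        (mem_meets ends).2 ⟨b, hb, by rw [hends]; exact Sym2.mem_mk_left b c⟩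
      have hes : e ∈ s := (key he).2 het
      exact Relation.ReflTransGen.tail ih ((og_adj ends).2 ⟨hne, e, hes, hends⟩)

/-- A red path from `x` never uses an edge meeting the red cluster of `z` when `x` is outside that cluster. [folklore] -/
theorem cl_subset_cl_sdiff_meets {t : Finset ι} {x z : V} (hx : x ∉ CL[t, z]) :
    CL[t, x] ⊆ CL[t \ MEETS[CL[t, z]], x] := by
  intro u hu
  rw [mem_cl, SimpleGraph.reachable_iff_reflTransGen] at hu ⊢
  induction hu with
  | refl => exact Relation.ReflTransGen.refl
  | @tail b c hab hbc ih =>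
    obtain ⟨hne, e, het, hends⟩ := (og_adj ends).1 hbc
    have hxb : (OG[t]).Reachable x b := (SimpleGraph.reachable_iff_reflTransGen _ _).2 hab
    have hxc : (OG[t]).Reachable x c := hxb.trans (SimpleGraph.Adj.reachable ((og_adj ends).2 ⟨hne, e, het, hends⟩))
    have he : e ∉ MEETS[CL[t, z]] := by
      intro hem
      obtain ⟨v, hv, hve⟩ := (mem_meets ends).1 hem
      rw [hends, Sym2.mem_iff] at hve
      have hzv : (OG[t]).Reachable z v := (mem_cl ends).1 hv
      have hxv : (OG[t]).Reachable x v := by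
        rcases hve with rfl | rfl
        · exact hxb
        · exact hxc
      exact hx ((mem_cl ends).2 (hzv.trans hxv.symm))
    exact Relation.ReflTransGen.tail ih ((og_adj ends).2 ⟨hne, e, mem_sdiff.2 ⟨het, he⟩, hends⟩)

omit [Fintype ι] [DecidableEq ι] in
/-- If every edge meeting `z` is the edge `e₀` and `e₀` is not red, the red cluster of `z` is `{z}`. [folklore] -/
theorem cl_eq_singleton_of_leaf {z : V} {e₀ : ι} (hleaf : ∀ e, z ∈ ends e → e = e₀) {s : Finset ι} (hs : e₀ ∉ s) :
    CL[s, z] = {z} := by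
  ext v
  rw [mem_cl, mem_singleton, SimpleGraph.reachable_iff_reflTransGen]
  constructor
  · intro hv
    induction hv with
    | refl => rfl
    | @tail b c _ hbc ih =>
      rw [ih] at hbc
      obtain ⟨_, e, hes, hends⟩ := (og_adj ends).1 hbc
      have hz : z ∈ ends e := by rw [hends]; exact Sym2.mem_mk_left z c
      exact absurd (hleaf e hz ▸ hes) hs
  · rintro rfl
    exact Relation.ReflTransGen.refl

/-- `Φ` preserves the red cluster of `z`. [folklore] -/
theorem cl_Phi (t : Finset ι) (z : V) : CL[PHI[t, z], z] = CL[t, z] :=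
  cl_eq_of_agree ends (flipOff_inter t _)

/-- `Φ` is an involution. [folklore] -/
theorem Phi_Phi (t : Finset ι) (z : V) : PHI[PHI[t, z], z] = t := by
  have hI : MEETS[CL[PHI[t, z], z]] = MEETS[CL[t, z]] := by rw [cl_Phi]
  rw [hI]
  ext e
  simp only [mem_flipOff]
  tauto

/-- `Φ` keeps the colour of every edge meeting the red cluster of `z`. [folklore] -/
theorem mem_Phi_of_mem_meets {t : Finset ι} {z : V} {e : ι} (he : e ∈ MEETS[CL[t, z]]) :
    e ∈ PHI[t, z] ↔ e ∈ t := by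
  simp only [mem_flipOff]
  tauto

/-- Domination: the red cluster of `x` is contained in its blue cluster after `Φ`, when `x` is outside the red cluster of `z`. [folklore] -/
theorem cl_subset_cl_compl_Phi {t : Finset ι} {x z : V} (hx : x ∉ CL[t, z]) :
    CL[t, x] ⊆ CL[(PHI[t, z])ᶜ, x] := by
  refine (cl_subset_cl_sdiff_meets ends hx).trans (cl_mono ends ?_ x)
  intro e he
  rw [mem_sdiff] at he
  rw [mem_compl, mem_flipOff]
  tauto

/-- **Two-colouring (coefficientwise) form of vdBHK Theorem 1.4 when the relay `z` is a leaf.**  For a finite multigraph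
`ends : ι → Sym2 V`, vertices `x ≠ z` such that every edge meeting `z` is the edge `e₀`, and monotone `f, g : Finset V → ℝ`:
`0 ≤ Σ_{t ⊆ ι} 1[x ∉ cl t z] 1[x ∉ cl tᶜ z] f(cl t x) (g(cl tᶜ z) − g(cl t z))` — on every two-colouring with no monochromatic
`x–z` path, the red cluster of `x` is (weakly) more compatible with the BLUE cluster of `z` than with the red one.  (prim-cplus-coupling
A5-COUPLING-gen22 §1.7; the general statement without the leaf hypothesis is open.)
[cite: VandenbergHaggstromKahn2005, Thm. 1.4 (p. 7)] -/
theorem twoColouring_bhk14_leaf (x z : V) (hxz : x ≠ z) (e₀ : ι) (hleaf : ∀ e, z ∈ ends e → e = e₀)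
    (f g : Finset V → ℝ) (hf : Monotone f) (hg : Monotone g) :
    0 ≤ ∑ t : Finset ι, (if x ∉ CL[t, z] ∧ x ∉ CL[tᶜ, z]
      then f (CL[t, x]) * (g (CL[tᶜ, z]) - g (CL[t, z])) else 0) := by
  -- the constraint and its symmetry under the colour swap
  set D : Finset ι → Prop := fun t => x ∉ CL[t, z] ∧ x ∉ CL[tᶜ, z] with hD
  have hDc : ∀ t, D tᶜ ↔ D t := fun t => by
    simp only [hD, compl_compl]; exact and_comm
  -- step (i): swap the colours globally in the cross term and in the pure-`f` term
  have swap : ∀ H : Finset ι → ℝ, ∑ t : Finset ι, H tᶜ = ∑ t : Finset ι, H t := fun H =>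
    Fintype.sum_bijective _ (compl_involutive (α := Finset ι)).bijective (fun t => H tᶜ) H fun _ => rfl
  have e1 : ∑ t : Finset ι, (if D t then f (CL[t, x]) * g (CL[tᶜ, z]) else 0)
      = ∑ t : Finset ι, (if D t then f (CL[tᶜ, x]) * g (CL[t, z]) else 0) := by
    rw [← swap (fun t => if D t then f (CL[tᶜ, x]) * g (CL[t, z]) else 0)]
    refine Finset.sum_congr rfl fun t _ => ?_
    simp only [hDc t, compl_compl]
  have e2 : ∑ t : Finset ι, (if D t then f (CL[tᶜ, x]) else 0) = ∑ t : Finset ι, (if D t then f (CL[t, x]) else 0) := by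
    rw [← swap (fun t => if D t then f (CL[t, x]) else 0)]
    refine Finset.sum_congr rfl fun t _ => ?_
    simp only [hDc t]
  have step1 : ∑ t : Finset ι, (if D t then f (CL[t, x]) * (g (CL[tᶜ, z]) - g (CL[t, z])) else 0)
      = ∑ t : Finset ι, (if D t then (g (CL[t, z]) - g {z}) * (f (CL[tᶜ, x]) - f (CL[t, x])) else 0) := by
    have hL : ∀ t : Finset ι, (if D t then f (CL[t, x]) * (g (CL[tᶜ, z]) - g (CL[t, z])) else 0)
        = (if D t then f (CL[t, x]) * g (CL[tᶜ, z]) else 0) - (if D t then f (CL[t, x]) * g (CL[t, z]) else 0) := by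
      intro t; split_ifs <;> ring
    have hR : ∀ t : Finset ι, (if D t then (g (CL[t, z]) - g {z}) * (f (CL[tᶜ, x]) - f (CL[t, x])) else 0)
        = (if D t then f (CL[tᶜ, x]) * g (CL[t, z]) else 0) - (if D t then f (CL[t, x]) * g (CL[t, z]) else 0)
          - g {z} * ((if D t then f (CL[tᶜ, x]) else 0) - (if D t then f (CL[t, x]) else 0)) := by
      intro t; split_ifs <;> ring
    simp only [hL, hR, Finset.sum_sub_distrib, ← Finset.mul_sum, e1, e2, sub_self, mul_zero, sub_zero]
  rw [step1]
  -- degenerate case: no edge meets `z`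
  by_cases hz0 : z ∈ ends e₀
  swap
  · have hnone : ∀ s : Finset ι, CL[s, z] = {z} := by
      intro s
      have hleaf' : ∀ e, z ∈ ends e → e = e₀ := hleaf
      -- every edge meeting z equals e₀, which does not meet z: so no edge meets z
      ext v
      rw [mem_cl, mem_singleton, SimpleGraph.reachable_iff_reflTransGen]
      constructor
      · intro hv
        induction hv with
        | refl => rfl
        | @tail b c _ hbc ih =>
          rw [ih] at hbc
          obtain ⟨_, e, _, hends⟩ := (og_adj ends).1 hbc
          have hz : z ∈ ends e := by rw [hends]; exact Sym2.mem_mk_left z c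
          exact absurd (hleaf' e hz ▸ hz) hz0
      · rintro rfl; exact Relation.ReflTransGen.refl
    refine Finset.sum_nonneg fun t _ => ?_
    simp only [hnone, sub_self, zero_mul]
    split_ifs <;> exact le_refl _
  -- step (ii): the weight vanishes unless `e₀ ∈ t`, and then the blue constraint is automatic
  set T : Finset (Finset ι) := univ.filter fun t => e₀ ∈ t ∧ x ∉ CL[t, z] with hT
  have memT : ∀ t, t ∈ T ↔ e₀ ∈ t ∧ x ∉ CL[t, z] := fun t => by simp [hT]
  set w : Finset ι → ℝ := fun t => g (CL[t, z]) - g {z} with hw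
  have hw0 : ∀ t, 0 ≤ w t := fun t => by
    simp only [hw, sub_nonneg]
    exact hg (Finset.singleton_subset_iff.2 (self_mem_cl ends t z))
  have step2 : ∑ t : Finset ι, (if D t then (g (CL[t, z]) - g {z}) * (f (CL[tᶜ, x]) - f (CL[t, x])) else 0)
      = ∑ t ∈ T, w t * (f (CL[tᶜ, x]) - f (CL[t, x])) := by
    have key : ∀ t : Finset ι, (if D t then (g (CL[t, z]) - g {z}) * (f (CL[tᶜ, x]) - f (CL[t, x])) else 0)
        = (if (e₀ ∈ t ∧ x ∉ CL[t, z]) then w t * (f (CL[tᶜ, x]) - f (CL[t, x])) else 0) := by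
      intro t
      by_cases he : e₀ ∈ t
      · have hblue : CL[tᶜ, z] = {z} := cl_eq_singleton_of_leaf ends hleaf (by rwa [mem_compl, not_not])
        have hDt : D t ↔ (e₀ ∈ t ∧ x ∉ CL[t, z]) := by
          simp only [hD, hblue, mem_singleton]
          exact ⟨fun h => ⟨he, h.1⟩, fun h => ⟨h.2, hxz⟩⟩
        simp only [hw]
        exact if_congr hDt rfl rfl
      · have hred : CL[t, z] = {z} := cl_eq_singleton_of_leaf ends hleaf he
        simp only [hred, sub_self, zero_mul, ite_self, he, false_and, if_false]
    rw [hT, Finset.sum_filter]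
    exact Finset.sum_congr rfl fun t _ => key t
  rw [step2, Finset.sum_congr rfl fun t _ => (mul_sub (w t) _ _), Finset.sum_sub_distrib, sub_nonneg]
  -- step (iii): reindex by the involution `Φ`
  have hPhiT : ∀ t ∈ T, PHI[t, z] ∈ T := by
    intro t ht
    obtain ⟨he, hx⟩ := (memT t).1 ht
    refine (memT _).2 ⟨?_, by rwa [cl_Phi]⟩
    have : e₀ ∈ MEETS[CL[t, z]] := (mem_meets ends).2 ⟨z, self_mem_cl ends t z, hz0⟩
    exact (mem_Phi_of_mem_meets ends this).2 he
  calc ∑ t ∈ T, w t * f (CL[t, x])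
      ≤ ∑ t ∈ T, w t * f (CL[(PHI[t, z])ᶜ, x]) :=
        Finset.sum_le_sum fun t ht =>
          mul_le_mul_of_nonneg_left (hf (cl_subset_cl_compl_Phi ends ((memT t).1 ht).2)) (hw0 t)
    _ = ∑ t ∈ T, w t * f (CL[tᶜ, x]) := by
        refine Finset.sum_bij' (fun t _ => PHI[t, z]) (fun t _ => PHI[t, z]) hPhiT hPhiT
          (fun t _ => Phi_Phi ends t z) (fun t _ => Phi_Phi ends t z) ?_
        intro t _
        simp only [hw, cl_Phi]

end CoefficientwiseNA

end Summit.CriticalPhenomena.PercolationContinuityZ3.Theorems
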